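import Literature.Computability.AlgebraicComplexity.GroupTheoreticMatMul
import Mathlib.Algebra.BigOperators.Group.Finset.Sigma
import Mathlib.Data.Fintype.Card

/-!
# ω-census, family (b′): a disjointness packing bound for STPP families (the census filter N5)

HONEST FRAMING (pub-omega census; verbatim): lottery ticket; floor = certified bounds/negative ranges.
Census bookkeeping, not progress on `ω`: an elementary counting consequence of the simultaneous triple
product property used as a FILTER by the STPP block-pattern census of small groups (pub-omega-stpp-2,
ENGINE.md §H, condition N5).  It refines the printed packing bounds `Σᵢ |Bᵢ||Cᵢ| ≤ |H|`,
`Σᵢ |Cᵢ||Aᵢ| ≤ |H|` (Blasiak et al. 2017, §2) for families with at least two blocks.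

Statement (additive notation, tree predicate `IsSTPP`).  Write `Xᵢ = Aᵢ − Bᵢ`, `Yⱼ = Bⱼ − Cⱼ`,
`Z_k = A_k − C_k`.  The defining implication of `IsSTPP` reads
`(s' − t) + (t' − u) = s − u'` with `s' ∈ Aᵢ, t ∈ Bᵢ, t' ∈ Bⱼ, u ∈ Cⱼ, s ∈ A_k, u' ∈ C_k`
`⟹ i = j = k ∧ s = s' ∧ t = t' ∧ u = u'`.  Hence for `i ≠ j` the sum-set `Xᵢ + Yⱼ` is DISJOINT
from every `Z_k`; translating `⊔_{j ≠ i} Yⱼ` by one element `x₀ ∈ Xᵢ` therefore lands in the complement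
of `⊔_k Z_k`, and counting gives, for every block `i` (all sets nonempty):

  `Σ_{j ≠ i} |Bⱼ||Cⱼ| + Σ_k |A_k||C_k| ≤ |H|`            (`stpp_sum_erase_card_mul_add_sum_card_mul_le`).

References: H. Cohn, R. Kleinberg, B. Szegedy, C. Umans, FOCS 2005 (arXiv:math/0511460), Def. 5.1,
proof of Thm. 5.3 ("`(s⁻¹t)(t'⁻¹u) = s'⁻¹u'` … iff `i = j = k` and `s = s'`, `t = t'`, `u = u'`");
J. Blasiak et al., Discrete Analysis 2017:3 (arXiv:1605.06702), Def. 2.2 and the packing bounds of §2.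
-/

open Finset

namespace Summit.MatrixMultiplication.OmegaCensus

open Literature.Computability.AlgebraicComplexity

variable {H : Type*} [AddCommGroup H] [DecidableEq H] {N : ℕ} {A B C : Fin N → Finset H}

omit [DecidableEq H] in
/-- The difference map `(k, s, u') ↦ s − u'` is injective on `Σ_k A_k × C_k` for an STPP family whose
`B`-sets are nonempty (pattern `(k', k', k)` of the definition). [folklore] -/
theorem stpp_injOn_sub_AC (hS : IsSTPP A B C) (hB : ∀ i, (B i).Nonempty) :
    Set.InjOn (fun q : Σ _ : Fin N, H × H => q.2.1 - q.2.2)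
      ((Finset.univ.sigma fun k => A k ×ˢ C k : Finset (Σ _ : Fin N, H × H)) : Set _) := by
  rintro ⟨k, s, u'⟩ hq ⟨k', s'', u''⟩ hq' heq
  simp only [Finset.coe_sigma, Finset.coe_product, Set.mem_sigma_iff, Finset.coe_univ, Set.mem_univ,
    Set.mem_prod, Finset.mem_coe, true_and] at hq hq'
  obtain ⟨t, ht⟩ := hB k'
  have heq' : s - u' = s'' - u'' := heq
  obtain ⟨-, hkk, hss, -, huu⟩ := hS k' k' k s hq.1 s'' hq'.1 t ht t ht u'' hq'.2 u' hq.2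
    (by rw [sub_self, add_zero, ← sub_eq_zero.2 heq'.symm]; abel)
  subst hkk; subst hss; subst huu
  rfl

omit [DecidableEq H] in
/-- The translated difference map `(j, t', u) ↦ x₀ + (t' − u)` is injective on `Σ_j B_j × C_j` for an
STPP family whose `A`-sets are nonempty (pattern `(j', j, j')` of the definition). [folklore] -/
theorem stpp_injOn_add_sub_BC (hS : IsSTPP A B C) (hA : ∀ i, (A i).Nonempty) (x₀ : H)
    (S : Finset (Fin N)) :
    Set.InjOn (fun q : Σ _ : Fin N, H × H => x₀ + (q.2.1 - q.2.2))
      ((S.sigma fun j => B j ×ˢ C j : Finset (Σ _ : Fin N, H × H)) : Set _) := by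
  rintro ⟨j, t', u⟩ hq ⟨j', t'', u''⟩ hq' heq
  simp only [Finset.coe_sigma, Finset.coe_product, Set.mem_sigma_iff, Set.mem_prod, Finset.mem_coe]
    at hq hq'
  obtain ⟨a, ha⟩ := hA j'
  have heq' : t' - u = t'' - u'' := add_left_cancel heq
  obtain ⟨hjj, -, -, htt, huu⟩ := hS j' j j' a ha a ha t'' hq'.2.1 t' hq.2.1 u hq.2.2 u'' hq'.2.2
    (by rw [sub_self, zero_add, ← sub_eq_zero.2 heq']; abel)
  subst hjj; subst htt; subst huu
  rfl

/-- **Disjointness packing bound (census filter N5).**  For an STPP family `(Aᵢ, Bᵢ, Cᵢ)_{i<N}` with all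
sets nonempty in a finite abelian group `H` and any block `i`:
`Σ_{j ≠ i} |Bⱼ||Cⱼ| + Σ_k |A_k||C_k| ≤ |H|` (only the `A`- and `B`-sets need to be nonempty).  Proof: pick
`s₀ ∈ Aᵢ`, `t₀ ∈ Bᵢ`; the elements
`(s₀ − t₀) + (t' − u)` (`t' ∈ Bⱼ`, `u ∈ Cⱼ`, `j ≠ i`) are pairwise distinct, the elements `s − u'`
(`s ∈ A_k`, `u' ∈ C_k`) are pairwise distinct, and no element of the first kind equals one of the second
kind — else `(s₀ − s) + (t' − t₀) + (u' − u) = 0` would force `i = j` by `IsSTPP`. [folklore] -/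
theorem stpp_sum_erase_card_mul_add_sum_card_mul_le [Fintype H] (hS : IsSTPP A B C)
    (hA : ∀ i, (A i).Nonempty) (hB : ∀ i, (B i).Nonempty) (i : Fin N) :
    ∑ j ∈ Finset.univ.erase i, (B j).card * (C j).card + ∑ k, (A k).card * (C k).card ≤
      Fintype.card H := by
  classical
  obtain ⟨s₀, hs₀⟩ := hA i
  obtain ⟨t₀, ht₀⟩ := hB i
  set x₀ : H := s₀ - t₀ with hx₀
  set SY : Finset (Σ _ : Fin N, H × H) := (Finset.univ.erase i).sigma fun j => B j ×ˢ C j with hSY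
  set SZ : Finset (Σ _ : Fin N, H × H) := Finset.univ.sigma fun k => A k ×ˢ C k with hSZ
  set f : (Σ _ : Fin N, H × H) → H := fun q => x₀ + (q.2.1 - q.2.2) with hf
  set g : (Σ _ : Fin N, H × H) → H := fun q => q.2.1 - q.2.2 with hg
  have hcardY : (SY.image f).card = ∑ j ∈ Finset.univ.erase i, (B j).card * (C j).card := by
    rw [Finset.card_image_of_injOn (stpp_injOn_add_sub_BC hS hA x₀ _), Finset.card_sigma]
    simp [Finset.card_product]
  have hcardZ : (SZ.image g).card = ∑ k, (A k).card * (C k).card := by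
    rw [Finset.card_image_of_injOn (stpp_injOn_sub_AC hS hB), Finset.card_sigma]
    simp [Finset.card_product]
  have hdisj : Disjoint (SY.image f) (SZ.image g) := by
    rw [Finset.disjoint_left]
    intro y hy hz
    rw [Finset.mem_image] at hy hz
    obtain ⟨⟨j, t', u⟩, hq, rfl⟩ := hy
    obtain ⟨⟨k, s, u'⟩, hq', heq⟩ := hz
    simp only [hSY, hSZ, Finset.mem_sigma, Finset.mem_erase, Finset.mem_univ, Finset.mem_product,
      true_and, and_true] at hq hq'
    have hrel : (s₀ - s) + (t' - t₀) + (u' - u) = 0 := by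
      have : s - u' = (s₀ - t₀) + (t' - u) := heq
      rw [← sub_eq_zero.2 this.symm]; abel
    obtain ⟨hij, -, -, -, -⟩ := hS i j k s hq'.1 s₀ hs₀ t₀ ht₀ t' hq.2.1 u hq.2.2 u' hq'.2 hrel
    exact hq.1 hij.symm
  calc ∑ j ∈ Finset.univ.erase i, (B j).card * (C j).card + ∑ k, (A k).card * (C k).card
      = (SY.image f).card + (SZ.image g).card := by rw [hcardY, hcardZ]
    _ = (SY.image f ∪ SZ.image g).card := (Finset.card_union_of_disjoint hdisj).symm
    _ ≤ Fintype.card H := Finset.card_le_univ _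

omit [DecidableEq H] in
/-- The translated difference map `(i, s', t) ↦ (s' − t) + y₀` is injective on `Σ_i A_i × B_i` for an
STPP family whose `C`-sets are nonempty (pattern `(i, i', i')` of the definition). [folklore] -/
theorem stpp_injOn_sub_add_AB (hS : IsSTPP A B C) (hC : ∀ i, (C i).Nonempty) (y₀ : H)
    (S : Finset (Fin N)) :
    Set.InjOn (fun q : Σ _ : Fin N, H × H => (q.2.1 - q.2.2) + y₀)
      ((S.sigma fun i => A i ×ˢ B i : Finset (Σ _ : Fin N, H × H)) : Set _) := by
  rintro ⟨i, s', t⟩ hq ⟨i', s'', t''⟩ hq' heq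
  simp only [Finset.coe_sigma, Finset.coe_product, Set.mem_sigma_iff, Set.mem_prod, Finset.mem_coe]
    at hq hq'
  obtain ⟨u, hu⟩ := hC i'
  have heq' : s' - t = s'' - t'' := add_right_cancel heq
  obtain ⟨hii, -, hss, htt, -⟩ := hS i i' i' s'' hq'.2.1 s' hq.2.1 t hq.2.2 t'' hq'.2.2 u hu u hu
    (by rw [sub_self, add_zero, ← sub_eq_zero.2 heq']; abel)
  subst hii; subst hss; subst htt
  rfl

/-- **Disjointness packing bound, mirror form (census filter N5).**  For an STPP family with nonempty
`B`- and `C`-sets in a finite abelian group `H` and any block `j`: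
`Σ_{i ≠ j} |Aᵢ||Bᵢ| + Σ_k |A_k||C_k| ≤ |H|` (translate `⊔_{i ≠ j} (Aᵢ − Bᵢ)` by one element of `Bⱼ − Cⱼ`;
the translate misses every `A_k − C_k`). [folklore] -/
theorem stpp_sum_erase_card_mul_add_sum_card_mul_le' [Fintype H] (hS : IsSTPP A B C)
    (hB : ∀ i, (B i).Nonempty) (hC : ∀ i, (C i).Nonempty) (j : Fin N) :
    ∑ i ∈ Finset.univ.erase j, (A i).card * (B i).card + ∑ k, (A k).card * (C k).card ≤
      Fintype.card H := by
  classical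
  obtain ⟨t₀, ht₀⟩ := hB j
  obtain ⟨u₀, hu₀⟩ := hC j
  set y₀ : H := t₀ - u₀ with hy₀
  set SX : Finset (Σ _ : Fin N, H × H) := (Finset.univ.erase j).sigma fun i => A i ×ˢ B i with hSX
  set SZ : Finset (Σ _ : Fin N, H × H) := Finset.univ.sigma fun k => A k ×ˢ C k with hSZ
  set f : (Σ _ : Fin N, H × H) → H := fun q => (q.2.1 - q.2.2) + y₀ with hf
  set g : (Σ _ : Fin N, H × H) → H := fun q => q.2.1 - q.2.2 with hg
  have hcardX : (SX.image f).card = ∑ i ∈ Finset.univ.erase j, (A i).card * (B i).card := by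
    rw [Finset.card_image_of_injOn (stpp_injOn_sub_add_AB hS hC y₀ _), Finset.card_sigma]
    simp [Finset.card_product]
  have hcardZ : (SZ.image g).card = ∑ k, (A k).card * (C k).card := by
    rw [Finset.card_image_of_injOn (stpp_injOn_sub_AC hS hB), Finset.card_sigma]
    simp [Finset.card_product]
  have hdisj : Disjoint (SX.image f) (SZ.image g) := by
    rw [Finset.disjoint_left]
    intro y hy hz
    rw [Finset.mem_image] at hy hz
    obtain ⟨⟨i, s', t⟩, hq, rfl⟩ := hy
    obtain ⟨⟨k, s, u'⟩, hq', heq⟩ := hz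
    simp only [hSX, hSZ, Finset.mem_sigma, Finset.mem_erase, Finset.mem_univ, Finset.mem_product,
      true_and, and_true] at hq hq'
    have hrel : (s' - s) + (t₀ - t) + (u' - u₀) = 0 := by
      have : s - u' = (s' - t) + (t₀ - u₀) := heq
      rw [← sub_eq_zero.2 this.symm]; abel
    obtain ⟨hij, -, -, -, -⟩ := hS i j k s hq'.1 s' hq.2.1 t hq.2.2 t₀ ht₀ u₀ hu₀ u' hq'.2 hrel
    exact hq.1 hij
  calc ∑ i ∈ Finset.univ.erase j, (A i).card * (B i).card + ∑ k, (A k).card * (C k).card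
      = (SX.image f).card + (SZ.image g).card := by rw [hcardX, hcardZ]
    _ = (SX.image f ∪ SZ.image g).card := (Finset.card_union_of_disjoint hdisj).symm
    _ ≤ Fintype.card H := Finset.card_le_univ _

omit [DecidableEq H] in
/-- Cyclic symmetry `(A, B, C) ↦ (B, C, A)` of `IsSTPP` (read the defining relation with indices
`(i, j, k) ↦ (k, i, j)`); proof as in the tree's `IsSTPP.rotate`
(`Literature/Barriers/MatrixMultiplication/TricoloredSumFreeBarrier.lean`), restated here to keep this
file's imports minimal. [folklore] -/
theorem stpp_rotate (h : IsSTPP A B C) : IsSTPP B C A := by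
  intro i j k s hs s' hs' t ht t' ht' u hu u' hu' he
  have he' : (u' - u) + (s' - s) + (t' - t) = 0 := by rw [← he]; abel
  obtain ⟨h1, h2, h3, h4, h5⟩ := h k i j u hu u' hu' s hs s' hs' t ht t' ht' he'
  exact ⟨h2, (h1.trans h2).symm, h4, h5, h3⟩

/-- The six disjointness packing bounds of the census filter N5, as one statement: for an STPP family
with all sets nonempty in a finite abelian group `H` and any block `i`, writing `P = Σ|A||B|`,
`Q = Σ|B||C|`, `R = Σ|C||A|`:  `(Q − |Bᵢ||Cᵢ|) + R ≤ |H|`, `(P − |Aᵢ||Bᵢ|) + R ≤ |H|`,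
`(R − |Cᵢ||Aᵢ|) + P ≤ |H|`, `(Q − |Bᵢ||Cᵢ|) + P ≤ |H|`, `(P − |Aᵢ||Bᵢ|) + Q ≤ |H|`, `(R − |Cᵢ||Aᵢ|) + Q ≤ |H|`
(the second sum written in the orientation produced by the cyclic symmetry). [folklore] -/
theorem stpp_disjointness_packing [Fintype H] (hS : IsSTPP A B C) (hA : ∀ i, (A i).Nonempty)
    (hB : ∀ i, (B i).Nonempty) (hC : ∀ i, (C i).Nonempty) (i : Fin N) :
    (∑ j ∈ Finset.univ.erase i, (B j).card * (C j).card + ∑ k, (A k).card * (C k).card ≤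
        Fintype.card H) ∧
    (∑ j ∈ Finset.univ.erase i, (A j).card * (B j).card + ∑ k, (A k).card * (C k).card ≤
        Fintype.card H) ∧
    (∑ j ∈ Finset.univ.erase i, (C j).card * (A j).card + ∑ k, (B k).card * (A k).card ≤
        Fintype.card H) ∧
    (∑ j ∈ Finset.univ.erase i, (B j).card * (C j).card + ∑ k, (B k).card * (A k).card ≤
        Fintype.card H) ∧
    (∑ j ∈ Finset.univ.erase i, (A j).card * (B j).card + ∑ k, (C k).card * (B k).card ≤
        Fintype.card H) ∧
    (∑ j ∈ Finset.univ.erase i, (C j).card * (A j).card + ∑ k, (C k).card * (B k).card ≤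
        Fintype.card H) := by
  have h1 := stpp_rotate hS
  have h2 := stpp_rotate h1
  exact ⟨stpp_sum_erase_card_mul_add_sum_card_mul_le hS hA hB i,
    stpp_sum_erase_card_mul_add_sum_card_mul_le' hS hB hC i,
    stpp_sum_erase_card_mul_add_sum_card_mul_le h1 hB hC i,
    stpp_sum_erase_card_mul_add_sum_card_mul_le' h1 hC hA i,
    stpp_sum_erase_card_mul_add_sum_card_mul_le h2 hC hA i,
    stpp_sum_erase_card_mul_add_sum_card_mul_le' h2 hA hB i⟩

end Summit.MatrixMultiplication.OmegaCensus
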